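import Summits.ResolutionOfSingularities.ResolutionOfSingularities.Theorems.LossShear
import HarnessLib

/-!
# LossShearRun — the laws (L_R) and (L_X1) of NODE-g28 §6.4 at the run-state level

decomp-res-lens-3, gen 28 (sequel of `Theorems.LossShear`; TOOLS at 0, critic letter rows 220i/220k).
`LossEpisode.runBeta W s u i j l` = `β` of the residual polygon of a run state `(i, j, l; k, m)` read in the frame
`(j, i ; l)` (loss wall, run wall ; free letter).  Laws: `runBeta_R_lt` — an R-arrow (chart of the run wall `i`, untranslated)
from a HEAVY run state (`q ≤ m + s`) makes `β` drop strictly ([CJS2020] Lemma 13.2 = `LossPolygon3.betaOf_polyPts_succ_chart_snd_lt`);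
`runBeta_X1_le` — an X1-arrow (chart of the loss wall `j`, translated only along the free letter `l`) does not increase `β`
([CJS2020] Lemma 13.1 after the vertex preparation of `Theorems.LossShear`: `betaOf_polyPts_succ_chart_fst_translated_le`).
-/

open MvPolynomial Finset
open Literature.AlgebraicGeometry.Resolution
open Literature.AlgebraicGeometry.Resolution.Hauser2010
open Literature.AlgebraicGeometry.Resolution.PointBlowup
open Summit.ResolutionOfSingularities.ResolutionOfSingularities.Theorems.TightDefectClasses
open Summit.ResolutionOfSingularities.ResolutionOfSingularities.Theorems.TightDefectStrongWalks
open Summit.ResolutionOfSingularities.ResolutionOfSingularities.Theorems.ItineraryCutClasses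
open Summit.ResolutionOfSingularities.ResolutionOfSingularities.Theorems.BoundaryLedger
open Summit.ResolutionOfSingularities.ResolutionOfSingularities.Theorems.ProximityCut
open Summit.ResolutionOfSingularities.ResolutionOfSingularities.Theorems.LossExitCone

/-! ## §4 Run-state level: the laws (L_R) and (L_X1) of NODE-g28 §6.4 on the carrier of `Theorems.LossEpisode` -/

namespace Summit.ResolutionOfSingularities.ResolutionOfSingularities.Theorems.LossEpisode

open Summit.ResolutionOfSingularities.ResolutionOfSingularities.Theorems.LossPolygon

variable {K : Type} [Field K] [DecidableEq K] {q : ℕ} {s₀ : State (Fin 3) K}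

/-- `β` of a run state `(i, j, l ; k, m)`: the vertex ordinate of the residual polygon in the frame (loss wall `j`, run wall `i` ;
free letter `l`) — the measure Θ of NODE-g28 §6.4. [CJS2020 Def. 11.1; new for the walk] -/
noncomputable def runBeta (W : ForcedWalk q s₀) (s u : ℕ) (i j l : Fin 3) : ℚ :=
  betaOf (polyPts s (W.st u).r j i l (W.st u).F)

/-- Wall values of a run state. [new; elementary] -/
theorem IsRunState.r_apply {W : ForcedWalk q s₀} {s u : ℕ} {i j l : Fin 3} {k m : ℕ} (hS : IsRunState W s u i j l k m) :
    (W.st u).r i = k ∧ (W.st u).r j = m ∧ (W.st u).r l = 0 := by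
  obtain ⟨hij, hli, hlj, -, -, hr, -⟩ := hS
  refine ⟨?_, ?_, ?_⟩
  · rw [hr, Finsupp.add_apply, Finsupp.single_eq_same, Finsupp.single_apply, if_neg (fun h => hij h.symm), add_zero]
  · rw [hr, Finsupp.add_apply, Finsupp.single_apply, if_neg hij, Finsupp.single_eq_same, zero_add]
  · rw [hr, Finsupp.add_apply, Finsupp.single_apply, if_neg (fun h => hli h.symm), Finsupp.single_apply,
      if_neg (fun h => hlj h.symm), add_zero]

/-- **LAW (L_R) (PROVED): an R-arrow from a HEAVY run state strictly lowers `β`.**  R = untranslated move in the chart of the run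
wall `i` (`runState_next`, first case); heavy loss wall `q ≤ m + s` (automatic on a lossy tail, `tail_sorts_heavy`) gives `α < 1`,
and `β' = β − (1 − α)` (tree `betaOf_polyPts_succ_chart_snd_lt`). [CJS2020 Lemma 13.4 (0:1)-case, for the walk; new] -/
theorem runBeta_R_lt (hroot : IsRoot q s₀) (W : ForcedWalk q s₀) {s u : ℕ} {i j l : Fin 3} {k m : ℕ}
    (hS : IsRunState W s u i j l k m) (hm : q ≤ m + s) (hq : q ≤ k + m + s) (hju : W.j u = i) (hbu : W.b u = 0)
    (hS' : IsRunState W s (u + 1) i j l (k + m + s - q) m) :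
    runBeta W s (u + 1) i j l < runBeta W s u i j l := by
  obtain ⟨hri, hrj, hrl⟩ := hS.r_apply
  obtain ⟨hri', hrj', hrl'⟩ := hS'.r_apply
  obtain ⟨hij, hli, hlj, -, -, -, -⟩ := hS
  unfold runBeta
  refine betaOf_polyPts_succ_chart_snd_lt hroot W u (Ne.symm hij) (Ne.symm hlj) (Ne.symm hli) hju hbu ?_ ?_ hrl hrl' ?_
  · rw [hrj', hrj]
  · rw [hri', hrj, hri]; omega
  · rw [hrj]; omega

/-- **LAW (L_X1) (PROVED): an X1-arrow from a HEAVY run state does not raise `β`.**  X1 = move in the chart of the loss wall `j`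
translated only along the free letter `l` (`runState_next`, second case: `b_u i = 0`; `b_u j = 0` on the exceptional letter);
`β' = γ⁻(Δ*) ≤ β(Δ*) = β` by the V-lemma. [CJS2020 Lemma 13.3 (1:0)-case in prepared coordinates, for the walk; new] -/
theorem runBeta_X1_le (hroot : IsRoot q s₀) (W : ForcedWalk q s₀) {s u : ℕ} {i j l : Fin 3} {k m : ℕ}
    (hS : IsRunState W s u i j l k m) (hm : q ≤ m + s) (hq : q ≤ k + m + s) (hju : W.j u = j) (hbi : W.b u i = 0)
    (hS' : IsRunState W s (u + 1) i j l k (k + m + s - q)) :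
    runBeta W s (u + 1) i j l ≤ runBeta W s u i j l := by
  obtain ⟨hri, hrj, hrl⟩ := hS.r_apply
  obtain ⟨hri', hrj', hrl'⟩ := hS'.r_apply
  obtain ⟨hij, hli, hlj, -, -, -, -⟩ := hS
  have hbj : W.b u j = 0 := by rw [← hju]; exact W.onExc u
  have hb : ∀ w, w ≠ l → W.b u w = 0 := by
    intro w hw
    rcases fin3_eq_or i j l w hij (Ne.symm hli) (Ne.symm hlj) with h | h | h
    · subst h; exact hbi
    · subst h; exact hbj
    · exact absurd h hw
  unfold runBeta
  refine betaOf_polyPts_succ_chart_fst_translated_le hroot W u (Ne.symm hij) (Ne.symm hlj) (Ne.symm hli) hju hb ?_ ?_ hrl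
    hrl' ?_
  · rw [hri', hri]
  · rw [hrj', hrj, hri]; omega
  · rw [hrj]; omega

end Summit.ResolutionOfSingularities.ResolutionOfSingularities.Theorems.LossEpisode
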